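import Summits.ResolutionOfSingularities.ResolutionOfSingularities.Theorems.PurelyInseparableDim4ScopeEdge
import Summits.ResolutionOfSingularities.ResolutionOfSingularities.Theorems.PurelyInseparableDim4ScopeWitness
import HarnessLib
import HarnessLib.Audit.Tags

/-!
# Purely inseparable fourfolds — UNIFORM BLINDNESS ALONG A POLYNOMIAL CURVE of `q`-fold points: the child at EVERY
# point `φ(β)` of the curve is OUT OF COORDINATE SCOPE, for every field `K` and every `β ∈ K`
# [OURS · counted 0 · a statement about OUR frame-v4 scope predicate, not about resolution]

Census cell «res-dim4-pi» (D-0157 DOOR 2); seat res-rescue-typ-3 g8 (rescue base on loan per director-resolution DR-E8 (4)).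
Def-free brick for the ∀K column's residue (memo `FLAT-ABSORPTION.md` §6: after flat absorption the remaining
obstruction is B's replies along NON-FLAT positive-dimensional components of the `q`-fold locus).  The single-state
blindness certificates of record (res-dim4-p-13's `.mono`/`.rat`, res-dim4-p-3's `not_inCoordinateScope_of_ringHom`,
res-dim4-p-8's COAT families) are all instances of ONE statement at a translated point, made uniform in the point here:

* `eval_aeval_poly` / `eval_translate_add` / `aeval_translate_comp` — evaluation and composition plumbing between
  `MvPolynomial (Fin 4) K`, `Polynomial K` and translations.
* **`not_inCoordinateScope_translate_of_curve`**: let `φ : Fin 4 → K[u]` be a polynomial curve with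
  `aeval φ (D^{(α)} G) = 0` for all `0 < |α| < q` (the curve lies in the `q`-fold locus ideal `J_q⁺(G)`), let `V` be a set
  of coordinates outside which every `φ i` is NON-constant, and let `a` (supported off `V`) and `α₀` (`0 < |α₀| < q`) give
  `D^{(α₀)}G (φ(β) + a) ≠ 0`.  Then `¬ InCoordinateScope q (translate (φ(β)) G)` — the state moved to the point `φ(β)` is
  BLIND.  Proof: p-3's ring-map criterion with `K[x] → K[u]`, `x_i ↦ φ_i(β + u) − φ_i(β)` (a curve through the origin of
  the translated state inside `V(J_q⁺)`), `hasseDeriv_translate` (res-dim4-p-6).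
* `not_inCoordinateScope_translate_of_curve_of_bezout`: the same with the non-vanishing supplied UNIFORMLY by a Bezout
  identity `Σ_r c_r(u) · (D^{(α_r)}G)(φ(u) + a_r) = t(u)` and `t(β) ≠ 0` — so one identity serves every `β` off the roots of
  `t` (for `t = u^m (u+1)^n`: every `β ∉ 𝔽₂`-grid point of the curve).
Nothing here proves resolution of singularities in dimension ≥ 4 / characteristic `p`; F4-C(2,2) stays OPEN.  Counted 0;
AI work, weaker than expert review.
bears_on: LADDER-RESOLUTION:D157-DOOR2 (res-dim4-pi · F4-C ∀K column · uniform curve blindness).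
Supports stmt-ResolutionOfSingularities-16155 (helper).
-/

set_option linter.dupNamespace false

noncomputable section
open MvPolynomial Finset
open scoped BigOperators Polynomial
namespace Summit.ResolutionOfSingularities.ResolutionOfSingularities.Theorems.PIDim4

namespace CurveBlind

open Literature.AlgebraicGeometry.Resolution
open ScopeDynamics IsolationCert

variable {K : Type} [Field K]

/-! ## 1. Plumbing -/

/-- Evaluating `aeval ψ g : K[u]` at `x` = evaluating `g` at the point `(ψ i)(x)`. [folklore] -/
theorem eval_aeval_poly (ψ : Fin 4 → K[X]) (g : MvPolynomial (Fin 4) K) (x : K) :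
    Polynomial.eval x (MvPolynomial.aeval ψ g) = MvPolynomial.eval (fun i => Polynomial.eval x (ψ i)) g := by
  induction g using MvPolynomial.induction_on with
  | C c => simp
  | add p q hp hq => simp [hp, hq]
  | mul_X p i hp => simp [hp]

/-- `G(x + b)` evaluated at `a` is `G(a + b)`. [folklore] -/
theorem eval_translate_add (a b : Fin 4 → K) (G : MvPolynomial (Fin 4) K) :
    MvPolynomial.eval a (PointBlowup.translate b G) = MvPolynomial.eval (a + b) G := by
  rw [translate_def]
  induction G using MvPolynomial.induction_on with
  | C c => simp
  | add p q hp hq => simp only [map_add, hp, hq]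
  | mul_X p i hp =>
    simp only [map_mul, MvPolynomial.aeval_X, map_add, MvPolynomial.eval_X, MvPolynomial.eval_C, hp]
    rfl

/-- Substituting the curve `u ↦ ψ + b` into `G(x + b)`... precisely: for `ψ i = (φ i).comp (X + C β) − C ((φ i).eval β)`,
`aeval ψ (translate (φ(β)) G) = (aeval φ G).comp (X + C β)`. [folklore] -/
theorem aeval_translate_comp (φ : Fin 4 → K[X]) (β : K) (G : MvPolynomial (Fin 4) K) :
    MvPolynomial.aeval (fun i => (φ i).comp (Polynomial.X + Polynomial.C β) - Polynomial.C ((φ i).eval β))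
        (PointBlowup.translate (fun i => (φ i).eval β) G) =
      (MvPolynomial.aeval φ G).comp (Polynomial.X + Polynomial.C β) := by
  rw [translate_def, ← AlgHom.comp_apply, MvPolynomial.comp_aeval, Polynomial.comp_eq_aeval,
    ← AlgHom.comp_apply, MvPolynomial.comp_aeval]
  have hfun : (fun i => (MvPolynomial.aeval fun i => (φ i).comp (Polynomial.X + Polynomial.C β) -
        Polynomial.C ((φ i).eval β)) (X i + C ((φ i).eval β) : MvPolynomial (Fin 4) K)) =
      fun i => (Polynomial.aeval (Polynomial.X + Polynomial.C β)) (φ i) := by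
    funext i
    simp [Polynomial.comp_eq_aeval]
  rw [hfun]

/-- A non-constant polynomial stays non-zero after the substitution `u ↦ u + β` and subtraction of a constant.
[folklore] -/
theorem comp_X_add_C_sub_C_ne_zero {f : K[X]} (hf : 0 < f.natDegree) (β c : K) :
    f.comp (Polynomial.X + Polynomial.C β) - Polynomial.C c ≠ 0 := by
  intro h
  have hdeg : (f.comp (Polynomial.X + Polynomial.C β) - Polynomial.C c).natDegree = f.natDegree := by
    rw [Polynomial.natDegree_sub_C, Polynomial.natDegree_comp, Polynomial.natDegree_X_add_C, mul_one]
  rw [h, Polynomial.natDegree_zero] at hdeg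
  omega

/-! ## 2. Uniform blindness along a polynomial curve -/

/-- **UNIFORM BLINDNESS ALONG A POLYNOMIAL CURVE.**  `φ` a polynomial curve inside the `q`-fold locus ideal of `G`
(`aeval φ (D^{(α)}G) = 0`, `0 < |α| < q`), every `φ i` with `i ∉ V` non-constant, and a point `a` supported off `V`
with `(D^{(α₀)}G)(φ(β) + a) ≠ 0`: then the state translated to the point `φ(β)` is OUT OF COORDINATE SCOPE.
[folklore] -/
theorem not_inCoordinateScope_translate_of_curve {q : ℕ} (G : MvPolynomial (Fin 4) K) (φ : Fin 4 → K[X]) (β : K)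
    (hJ : ∀ α : Fin 4 →₀ ℕ, 0 < α.degree → α.degree < q → MvPolynomial.aeval φ (hasseDeriv α G) = 0)
    (V : Finset (Fin 4)) (hV : ∀ i : Fin 4, i ∉ V → 0 < (φ i).natDegree)
    (α₀ : Fin 4 →₀ ℕ) (hα0 : 0 < α₀.degree) (hαq : α₀.degree < q) (a : Fin 4 → K)
    (haV : ∀ i ∈ V, a i = 0)
    (hne : MvPolynomial.eval (fun i => (φ i).eval β + a i) (hasseDeriv α₀ G) ≠ 0) :
    ¬ InCoordinateScope q (PointBlowup.translate (fun i => (φ i).eval β) G) := by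
  set b : Fin 4 → K := fun i => (φ i).eval β with hb
  set ψ : Fin 4 → K[X] := fun i => (φ i).comp (Polynomial.X + Polynomial.C β) - Polynomial.C ((φ i).eval β) with hψ
  refine not_inCoordinateScope_of_ringHom (MvPolynomial.aeval ψ).toRingHom ?_ ?_ V ?_ α₀ hα0 hαq a haV ?_
  · -- the curve kills `J_q⁺` of the translated polynomial
    intro α h0 hq
    rw [AlgHom.toRingHom_eq_coe, AlgHom.coe_toRingHom, ScopeDynamics.hasseDeriv_translate, hψ, aeval_translate_comp, hJ α h0 hq,
      Polynomial.zero_comp]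
  · -- the curve passes through the origin: `ψ i (0) = 0`
    intro g hg
    rw [AlgHom.toRingHom_eq_coe, AlgHom.coe_toRingHom] at hg
    have := congrArg (Polynomial.eval 0) hg
    rw [eval_aeval_poly, Polynomial.eval_zero] at this
    have hψ0 : (fun i => Polynomial.eval 0 (ψ i)) = (0 : Fin 4 → K) := by
      funext i
      simp [hψ]
    rwa [hψ0] at this
  · -- non-constant coordinates are non-zero on the curve
    intro i hi
    rw [AlgHom.toRingHom_eq_coe, AlgHom.coe_toRingHom, MvPolynomial.aeval_X]
    exact comp_X_add_C_sub_C_ne_zero (hV i hi) β _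
  · -- the witness of non-containment
    rw [ScopeDynamics.hasseDeriv_translate, eval_translate_add]
    have : (a + b) = fun i => (φ i).eval β + a i := by funext i; simp [hb, Pi.add_apply, add_comm]
    rw [this]
    exact hne

/-- **Uniform version with a Bezout identity**: if `Σ_r c_r · (D^{(α_r)}G)(φ + a_r) = t` in `K[u]` (each `a_r`
supported off `V`, `0 < |α_r| < q`) then at every `β` with `t(β) ≠ 0` the state translated to `φ(β)` is out of
coordinate scope. [folklore] -/
theorem not_inCoordinateScope_translate_of_curve_of_bezout {q : ℕ} (G : MvPolynomial (Fin 4) K)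
    (φ : Fin 4 → K[X]) (β : K)
    (hJ : ∀ α : Fin 4 →₀ ℕ, 0 < α.degree → α.degree < q → MvPolynomial.aeval φ (hasseDeriv α G) = 0)
    (V : Finset (Fin 4)) (hV : ∀ i : Fin 4, i ∉ V → 0 < (φ i).natDegree)
    {ι : Type} (R : Finset ι) (αr : ι → (Fin 4 →₀ ℕ)) (ar : ι → (Fin 4 → K)) (cr : ι → K[X]) (t : K[X])
    (hα : ∀ r ∈ R, 0 < (αr r).degree ∧ (αr r).degree < q) (ha : ∀ r ∈ R, ∀ i ∈ V, ar r i = 0)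
    (hbez : ∑ r ∈ R, cr r * MvPolynomial.aeval (fun i => φ i + Polynomial.C (ar r i)) (hasseDeriv (αr r) G) = t)
    (ht : t.eval β ≠ 0) :
    ¬ InCoordinateScope q (PointBlowup.translate (fun i => (φ i).eval β) G) := by
  classical
  -- some summand does not vanish at `β`
  have hsum : ∑ r ∈ R, (cr r).eval β *
      MvPolynomial.eval (fun i => (φ i).eval β + ar r i) (hasseDeriv (αr r) G) = t.eval β := by
    rw [← hbez, Polynomial.eval_finsetSum]
    refine Finset.sum_congr rfl fun r _ => ?_
    rw [Polynomial.eval_mul, eval_aeval_poly]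
    have hfun : (fun i => Polynomial.eval β (φ i + Polynomial.C (ar r i))) = fun i => (φ i).eval β + ar r i := by
      funext i
      simp
    rw [hfun]
  obtain ⟨r, hr, hne⟩ : ∃ r ∈ R, (cr r).eval β *
      MvPolynomial.eval (fun i => (φ i).eval β + ar r i) (hasseDeriv (αr r) G) ≠ 0 := by
    by_contra hall
    push Not at hall
    exact ht (by rw [← hsum]; exact Finset.sum_eq_zero hall)
  exact not_inCoordinateScope_translate_of_curve G φ β hJ V hV (αr r) (hα r hr).1 (hα r hr).2 (ar r) (ha r hr)
    (right_ne_zero_of_mul hne)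

end CurveBlind

end Summit.ResolutionOfSingularities.ResolutionOfSingularities.Theorems.PIDim4

end
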